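import Mathlib
import Summits.Ventures.HodgeRepro2.T6N5TateTwist
import Summits.Ventures.HodgeRepro2.T6N5Hyp
import Summits.Ventures.HodgeRepro2.T6N5LocalDatum
import Summits.Ventures.HodgeRepro2.T6N5LocalHyp
import Summits.Ventures.HodgeRepro2.T6N5Local
import Summits.Ventures.HodgeRepro2.T6N5LocalCharDatum
import Summits.Ventures.HodgeRepro2.T6N5LocalInertHyp
import Summits.Ventures.HodgeRepro2.T6N5LocalInert
import Summits.Ventures.HodgeRepro2.T6N5LocalInertCompletion

/-!
# T6N5LocalInertOnCompletion — Tier 6, M2 sub-step N5 (t6-p8's half): Theorem N5.T2 (inert case) INSTANTIATED on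
Mathlib's adic completions, with every character-side datum condition discharged by `T6N5LocalInertCompletion`

`mkInert` builds the inert local sign datum of `T6N5LocalCharDatum` on `E := L_w^×` (Mathlib's completion at an
inert place `w ∣ v` of a quadratic extension, p4's `T5AdicCompletionInert` setting) from the Layer-III carriers
(`U`, `F_v^×`, `ηF` = p4's norm character) and the Tate-side fields, which have no Mathlib model and stay
parameters (`Psi`, `Meas`, `epsT`, `ψ₀`, `ψ_δ`, `t`, `d_v`, the predicates `IsInert` / `IsNormalised`).
`N5Local_main_inert_completion` is `T6N5LocalInert.N5Local_main_inert` on it: the three character-side datum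
conditions `hU`, `hμ`, `hβ` are the theorems `U_antitone`, `μ_mem_U_zero` + `μ_eq_ηF`, `exists_CO_exact_level`
(no longer hypotheses), `hη` (`η_v² = 1`) is proved from the values of the norm character (`±1`); what remains as
hypotheses are the three displays (GGP-ex Prop. 3.1, Tate (3.2.2)–(3.2.3), BFGYYZ Thm 3.5 via `h35`), the
conventions, the Tate-side conditions (`hψδ`, `ht`, `hηt`, `hin`, `hψ0`) and the (A1) / Weil-side inputs
(`hA1`, `hW`, `hχW`) exactly as in `N5Local_main_inert`.
README §8(d): uses an L-value-free non-vanishing device: NO.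
-/

namespace Summit.Ventures.HodgeRepro2.T6.N5LocalInertOnCompletion

open Summit.Ventures.HodgeRepro2 IsDedekindDomain HeightOneSpectrum
  Summit.Ventures.HodgeRepro2.T6.N5LocalDatum Summit.Ventures.HodgeRepro2.T6.N5LocalCharDatum
  Summit.Ventures.HodgeRepro2.T6.N5LocalInertDatum Summit.Ventures.HodgeRepro2.T6.N5Local
  Summit.Ventures.HodgeRepro2.T6.N5LocalInert Summit.Ventures.HodgeRepro2.T6.Hyp
  Summit.Ventures.HodgeRepro2.T6.N5LocalInertCompletion

-- `K`, `L` in `Type` (universe `0`): `CharDatum.E : Type`.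
variable {K : Type} [Field K] [NumberField K] (v : HeightOneSpectrum (NumberField.RingOfIntegers K))
  {L : Type} [Field L] [NumberField L] [Algebra K L] (w : HeightOneSpectrum (NumberField.RingOfIntegers L))
  [w.asIdeal.LiesOver v.asIdeal]
  [ContinuousSMul (v.adicCompletion K) (w.adicCompletion L)]
  [IsScalarTower K (v.adicCompletion K) (w.adicCompletion L)]

noncomputable section

/-- The Tate-side fields of the inert datum (no Mathlib model): the additive characters, the measures, Tate's
operations and ε-factor, the distinguished characters `ψ₀`, `ψ_δ`, the scaling element `t ∈ F_v^×`, the additive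
conductor `d_v`, the Weil-side data and the inert / normalisation predicates. -/
structure TateSide (E : Type) [CommGroup E] where
  /-- the additive characters of `E_v` -/
  Psi : Type
  /-- the Haar measures on `E_v` -/
  Meas : Type
  /-- `ω_s = |·|^s` -/
  omega : ℂ → (E →* ℂˣ)
  /-- the normalised absolute value -/
  nrm : E → ℝ
  /-- `ψ_a = ψ(a·)` -/
  tw : Psi → E → Psi
  /-- scaling of measures -/
  sc : ℝ → Meas → Meas
  /-- the self-dual measure of `ψ` -/
  sd : Psi → Meas
  /-- Tate's `ε(χ, ψ, dx)` -/
  epsT : (E →* ℂˣ) → Psi → Meas → ℂ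
  /-- `ψ_δ` -/
  ψδ : Psi
  /-- the Weil-side character -/
  χW : E →* ℂˣ
  /-- the Weil-side sign -/
  epsdW : ℤˣ
  /-- the (A1) predicate -/
  Theta : ℤˣ → (E →* ℂˣ) → Prop
  /-- the line signs -/
  ηLine : Fin 2 → ℤˣ
  /-- `η_v(u)` -/
  ηu : ℤˣ
  /-- the inert predicate -/
  IsInert : Prop
  /-- Proposition 3.1's normalisation predicate -/
  IsNormalised : Psi → Prop
  /-- the normalised `ψ₀` -/
  ψ0 : Psi
  /-- `t` with `ψ_δ = ψ₀(t·)` -/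
  t : E
  /-- `d_v = n(ψ_δ)` -/
  d : ℤ

/-- The inert local sign datum on `L_w^×`: the Layer-III carriers (`U v w ϖ`, `Fsub v w`, `ηF v w σ hind`) and
the Tate-side fields `T`. -/
def mkInert (ϖ : v.adicCompletionIntegers K) (σ : Gal(w.adicCompletion L/v.adicCompletion K))
    (hind : (T5AdicCompletionNormGroup.normGroup v w σ).index = 2) (T : TateSide (w.adicCompletion L)ˣ) :
    InertSignDatum where
  E := (w.adicCompletion L)ˣ
  U := U v w ϖ
  Fsub := Fsub v w
  η := ηF v w σ hind
  Psi := T.Psi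
  Meas := T.Meas
  omega := T.omega
  nrm := T.nrm
  tw := T.tw
  sc := T.sc
  sd := T.sd
  epsT := T.epsT
  ψδ := T.ψδ
  χW := T.χW
  epsdW := T.epsdW
  Theta := T.Theta
  ηLine := T.ηLine
  ηu := T.ηu
  IsInert := T.IsInert
  IsNormalised := T.IsNormalised
  ψ0 := T.ψ0
  t := T.t
  d := T.d

omit [ContinuousSMul (v.adicCompletion K) (w.adicCompletion L)]
  [IsScalarTower K (v.adicCompletion K) (w.adicCompletion L)] in
/-- `η_v² = 1`: the norm character takes the values `±1`. -/
theorem ηF_mul_self (σ : Gal(w.adicCompletion L/v.adicCompletion K))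
    (hind : (T5AdicCompletionNormGroup.normGroup v w σ).index = 2) :
    ηF v w σ hind * ηF v w σ hind = 1 := by
  ext x
  obtain ⟨y, hy⟩ := x.2
  have hx : x = ⟨T5UnramifiedCharacter.baseUnits v w y, ⟨y, rfl⟩⟩ := Subtype.ext hy.symm
  rw [MonoidHom.mul_apply, MonoidHom.one_apply, hx, ηF_baseUnits, ← map_mul, Int.units_mul_self, map_one]

/-- Theorem N5.T2 at an inert place on Mathlib's completions: `N5Local_main_inert` on `mkInert`, with `hU`,
`hμ`, `hβ`, `hη` discharged by `T6N5LocalInertCompletion`. Hypotheses: the inert setting (`hϖ`, `hϖS`, `hf`: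
inertia degree `≥ 2`, `h2`, `hσ`, `hind`), the displays `hG` (GGP-ex Prop. 3.1), `hT` (Tate (3.2.2)–(3.2.3)),
`h35` (BFGYYZ Thm 3.5), the conventions `hc`, the Tate-side conditions `hψδ`, `ht`, `hηt`, `hin`, `hψ0`, and the
(A1) / Weil-side inputs `hA1`, `hW`, `hχW`. -/
theorem N5Local_main_inert_completion {ϖ : v.adicCompletionIntegers K} (hϖ : Irreducible ϖ)
    (hϖS : Irreducible (algebraMap (v.adicCompletionIntegers K) (w.adicCompletionIntegers L) ϖ))
    (hf : 2 ≤ (Ideal.span {ϖ}).inertiaDeg'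
      (Ideal.span {algebraMap (v.adicCompletionIntegers K) (w.adicCompletionIntegers L) ϖ}))
    (h2 : Module.finrank (v.adicCompletion K) (w.adicCompletion L) = 2)
    (σ : Gal(w.adicCompletion L/v.adicCompletion K)) (hσ : σ ≠ 1)
    (hind : (T5AdicCompletionNormGroup.normGroup v w σ).index = 2) (T : TateSide (w.adicCompletion L)ˣ)
    (hG : GGP2012ex_Prop3_1 (mkInert v w ϖ σ hind T))
    (hT : Tate1979_3_2_2_3 T.epsT (fun ξ a => ((ξ a : ℂˣ) : ℂ)) T.tw T.sc T.nrm (fun _ => True))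
    (hc : (mkInert v w ϖ σ hind T).toCharDatum.Conventions)
    (hψδ : T.ψδ = T.tw T.ψ0 T.t) (ht : T.t ∈ Fsub v w)
    (hηt : ((ηF v w σ hind ⟨T.t, ht⟩ : ℂˣ) : ℂ) = (-1 : ℂ) ^ (T.d + 1))
    (hin : T.IsInert) (hψ0 : T.IsNormalised T.ψ0)
    (h35 : BFGYYZ2025_Thm3_5 (mkInert v w ϖ σ hind T).toLocalSignDatum)
    (hA1 : ∀ s : ℤˣ, ∃ α : (w.adicCompletion L)ˣ →* ℂˣ,
      (mkInert v w ϖ σ hind T).toLocalSignDatum.IsCO α ∧ T.Theta s α)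
    (hW : T.epsdW = 1) (hχW : (mkInert v w ϖ σ hind T).toLocalSignDatum.IsCS T.χW) :
    ∃ ξ : Fin 4 → (w.adicCompletion L)ˣ →* ℂˣ, LocalSolution (mkInert v w ϖ σ hind T).toLocalSignDatum ξ := by
  refine N5Local_main_inert (mkInert v w ϖ σ hind T) hG hT hc (U_antitone v w ϖ) hψδ ht hηt hin hψ0 ?_ ?_ h35
    hA1 hW (ηF_mul_self v w σ hind) hχW
  · refine ⟨μ w, ?_, μ_mem_U_zero v w ϖ⟩
    rw [CharDatum.isCS_iff]
    intro x
    exact μ_eq_ηF v w σ hσ h2 hϖ hϖS hind x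
  · intro n hn
    obtain ⟨β, hβF, hβs, hβc⟩ := exists_CO_exact_level v w hϖ hϖS hf n hn
    refine ⟨β, ?_, hβs, hβc⟩
    rw [CharDatum.isCO_iff]
    intro x
    exact hβF x.1 x.2

end

end Summit.Ventures.HodgeRepro2.T6.N5LocalInertOnCompletion
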